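import Summits.NavierStokesRegularity.FluidComputer.AlignedVorticityWeakLimitTools
import HarnessLib

/-!
# WEAK LIMITS OF ASYMPTOTICALLY ALIGNED VORTICITIES ARE UNIDIRECTIONAL

Cell `ns-blowup`, seat `ns-blowup-ecbridge-2` (g10; the E–C endpoint theory seat). LABEL: E–C typing
(KERNEL — pure analysis, no named fact). WHAT THIS IS NOT: not Navier–Stokes evidence — a compactness
device (no equation is used). Companion memo: `run/shared/lean/pub/ns-blowup/ecbridge2/ECBRIDGE-2-MEMO-9.md`.

* `norm_mul_norm_le_inner_integral_smul_curl` — if `w_j → V` pointwise, `‖w_j‖ ≤ K`, and on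
  `B(0, R)` the vorticity directions of `w_j` above thresholds `d_j → 0` are `ε_j`-aligned with
  `ε_j → 0`, then for non-negative `C¹` weights `ψ₁, ψ₂` supported in `B(0, R)` the weighted vorticity
  vectors of the LIMIT are positively parallel: `‖∫ψ₁ curl V‖ ‖∫ψ₂ curl V‖ ≤ ⟪∫ψ₁ curl V, ∫ψ₂ curl V⟫`
  (pre-limit near-parallelism with masses bounded by the mass bound, then the weak limit);
* **`exists_unidirectional_curl_of_tendsto_of_aligned`** — hence `curl V = |curl V| ζ₀` for ONE
  vector `ζ₀` (localise at pairs of points by normalised bump weights, equality in Cauchy–Schwarz).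
  NO CONVERGENCE OF DERIVATIVES IS ASSUMED: locally uniform (indeed bounded pointwise) convergence
  of the velocities transfers Giga–Miura's alignment hypothesis to the limit. Consumer: Giga–Miura
  2011 WITH THE CLAY FORCE (`ClayBlowupForcedAlignment.lean`).

References: Y. Giga, H. Miura, Comm. Math. Phys. 303 (2011) 289–300, §2.1 Prop. 2.2
[cite: GigaMiura2011, §2.1 Prop. 2.2].
-/

noncomputable section

namespace Summit.NavierStokesRegularity.FluidComputer

open MeasureTheory Set Function Filter Metric Topology
open scoped InnerProductSpace RealInnerProductSpace
open Literature.Analysis Literature.Analysis.FluidPDE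

/-! ### Near-parallelism passes to the weak limit -/

section Limit

variable {w : ℕ → (EuclideanSpace ℝ (Fin 3)) → (EuclideanSpace ℝ (Fin 3))} {V : (EuclideanSpace ℝ (Fin 3)) → (EuclideanSpace ℝ (Fin 3))} {K : ℝ}

/-- **The weighted vorticity vectors of the limit are positively parallel**: if `w_j → V`
pointwise (eventually `C¹`, `‖w_j‖ ≤ K`), `V ∈ C¹`, and on the ball `B(0, R)` the vorticity
directions of `w_j` above thresholds `d_j → 0` are `ε_j`-aligned, `ε_j → 0`, then for non-negative
`C¹` weights `ψ₁, ψ₂` supported in `B(0, R)`,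
`‖∫ψ₁ curl V‖ ‖∫ψ₂ curl V‖ ≤ ⟪∫ψ₁ curl V, ∫ψ₂ curl V⟫` (the pre-limit near-parallelism
`inner_ge_of_near_parallel`, with masses bounded by `norm_integral_smul_curl_le`, in the limit
`tendsto_integral_smul_curl_of_tendsto`). [folklore] -/
theorem norm_mul_norm_le_inner_integral_smul_curl (hw : ∀ᶠ j in atTop, ContDiff ℝ 1 (w j))
    (hV : ContDiff ℝ 1 V) (hK0 : 0 ≤ K) (hK : ∀ᶠ j in atTop, ∀ y, ‖w j y‖ ≤ K)
    (hconv : ∀ y, Tendsto (fun j => w j y) atTop (𝓝 (V y))) {R : ℝ} {ε d : ℕ → ℝ}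
    (hε : Tendsto ε atTop (𝓝 0)) (hd : Tendsto d atTop (𝓝 0)) (hε0 : ∀ j, 0 ≤ ε j)
    (hd0 : ∀ j, 0 ≤ d j)
    (halign : ∀ᶠ j in atTop, ∀ y ∈ ball (0 : (EuclideanSpace ℝ (Fin 3))) R, ∀ y' ∈ ball (0 : (EuclideanSpace ℝ (Fin 3))) R,
      d j < ‖curl (w j) y‖ → d j < ‖curl (w j) y'‖ →
        ‖vorticityDirection (curl (w j)) y - vorticityDirection (curl (w j)) y'‖ ≤ ε j)
    {ψ₁ ψ₂ : (EuclideanSpace ℝ (Fin 3)) → ℝ} (h₁ : ContDiff ℝ 1 ψ₁) (h₁c : HasCompactSupport ψ₁) (h₁0 : ∀ y, 0 ≤ ψ₁ y)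
    (h₁s : support ψ₁ ⊆ ball (0 : (EuclideanSpace ℝ (Fin 3))) R) (h₂ : ContDiff ℝ 1 ψ₂) (h₂c : HasCompactSupport ψ₂)
    (h₂0 : ∀ y, 0 ≤ ψ₂ y) (h₂s : support ψ₂ ⊆ ball (0 : (EuclideanSpace ℝ (Fin 3))) R) :
    ‖∫ y, ψ₁ y • curl V y‖ * ‖∫ y, ψ₂ y • curl V y‖ ≤
      ⟪∫ y, ψ₁ y • curl V y, ∫ y, ψ₂ y • curl V y⟫ := by
  -- constants of the two weights (made opaque)
  obtain ⟨I₁, hI₁⟩ : ∃ I : ℝ, I = ∫ y, ψ₁ y := ⟨_, rfl⟩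
  obtain ⟨I₂, hI₂⟩ : ∃ I : ℝ, I = ∫ y, ψ₂ y := ⟨_, rfl⟩
  obtain ⟨N₁, hN₁⟩ : ∃ N : ℝ, N = ∫ y, ‖fderiv ℝ ψ₁ y‖ := ⟨_, rfl⟩
  obtain ⟨N₂, hN₂⟩ : ∃ N : ℝ, N = ∫ y, ‖fderiv ℝ ψ₂ y‖ := ⟨_, rfl⟩
  have hI₁0 : 0 ≤ I₁ := by rw [hI₁]; exact integral_nonneg h₁0
  have hI₂0 : 0 ≤ I₂ := by rw [hI₂]; exact integral_nonneg h₂0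
  have hN₁0 : 0 ≤ N₁ := by rw [hN₁]; exact integral_nonneg fun y => norm_nonneg _
  have hN₂0 : 0 ≤ N₂ := by rw [hN₂]; exact integral_nonneg fun y => norm_nonneg _
  obtain ⟨Mb₁, hMb₁⟩ : ∃ M : ℝ, M = 2 * K * N₁ + 6 * I₁ := ⟨_, rfl⟩
  obtain ⟨Mb₂, hMb₂⟩ : ∃ M : ℝ, M = 2 * K * N₂ + 6 * I₂ := ⟨_, rfl⟩
  have hMb₁0 : 0 ≤ Mb₁ := by rw [hMb₁]; positivity
  have hMb₂0 : 0 ≤ Mb₂ := by rw [hMb₂]; positivity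
  obtain ⟨P₁, hP₁⟩ : ∃ P : ℝ, P = Mb₁ + 2 * I₁ := ⟨_, rfl⟩
  obtain ⟨P₂, hP₂⟩ : ∃ P : ℝ, P = Mb₂ + 2 * I₂ := ⟨_, rfl⟩
  have hP₁0 : 0 ≤ P₁ := by rw [hP₁]; positivity
  have hP₂0 : 0 ≤ P₂ := by rw [hP₂]; positivity
  obtain ⟨C₀, hC₀⟩ : ∃ C : ℝ, C = Mb₁ * P₂ + Mb₂ * P₁ + P₁ * P₂ := ⟨_, rfl⟩
  -- the pre-limit vectors
  obtain ⟨A₁, hA₁⟩ : ∃ A : ℕ → (EuclideanSpace ℝ (Fin 3)), ∀ j, A j = ∫ y, ψ₁ y • curl (w j) y := ⟨_, fun _ => rfl⟩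
  obtain ⟨A₂, hA₂⟩ : ∃ A : ℕ → (EuclideanSpace ℝ (Fin 3)), ∀ j, A j = ∫ y, ψ₂ y • curl (w j) y := ⟨_, fun _ => rfl⟩
  -- ### the pre-limit inequality, eventually
  have hsmall : ∀ᶠ j in atTop, ε j ≤ 1 / 2 ∧ d j ≤ 1 / 2 := by
    filter_upwards [hε.eventually (eventually_le_nhds (show (0 : ℝ) < 1 / 2 by norm_num)),
      hd.eventually (eventually_le_nhds (show (0 : ℝ) < 1 / 2 by norm_num))] with j h1 h2
    exact ⟨h1, h2⟩
  have hpre : ∀ᶠ j in atTop,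
      ‖A₁ j‖ * ‖A₂ j‖ - 2 * C₀ * (ε j + d j) ≤ ⟪A₁ j, A₂ j⟫ := by
    filter_upwards [hw, hK, halign, hsmall] with j hwj hKj halj hsm
    have hωc : Continuous (curl (w j)) := continuous_curl hwj
    obtain ⟨e, he1, hmass, he⟩ := exists_refDirection_of_aligned (ω := curl (w j))
      (S := ball (0 : (EuclideanSpace ℝ (Fin 3))) R) (hε0 j) (hd0 j) halj
    -- masses and defects
    obtain ⟨m₁, hm₁⟩ : ∃ m : ℝ, m = ∫ y, ψ₁ y * ‖curl (w j) y‖ := ⟨_, rfl⟩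
    obtain ⟨m₂, hm₂⟩ : ∃ m : ℝ, m = ∫ y, ψ₂ y * ‖curl (w j) y‖ := ⟨_, rfl⟩
    have hm₁0 : 0 ≤ m₁ := by
      rw [hm₁]; exact integral_nonneg fun y => mul_nonneg (h₁0 y) (norm_nonneg _)
    have hm₂0 : 0 ≤ m₂ := by
      rw [hm₂]; exact integral_nonneg fun y => mul_nonneg (h₂0 y) (norm_nonneg _)
    have hAm₁ : ‖A₁ j‖ ≤ m₁ := by rw [hA₁, hm₁]; exact norm_integral_smul_le_mass h₁0
    have hAm₂ : ‖A₂ j‖ ≤ m₂ := by rw [hA₂, hm₂]; exact norm_integral_smul_le_mass h₂0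
    have hD₁ : ‖A₁ j - m₁ • e‖ ≤ ε j * m₁ + 2 * d j * I₁ := by
      rw [hA₁, hm₁, hI₁]
      exact norm_integral_smul_sub_mass_smul_le hωc h₁.continuous h₁c h₁0 h₁s he
    have hD₂ : ‖A₂ j - m₂ • e‖ ≤ ε j * m₂ + 2 * d j * I₂ := by
      rw [hA₂, hm₂, hI₂]
      exact norm_integral_smul_sub_mass_smul_le hωc h₂.continuous h₂c h₂0 h₂s he
    -- mass bounds: `(1 − ‖e‖) mᵢ ≤ d Iᵢ`, `‖e‖ mᵢ ≤ ‖Aᵢ‖ + δᵢ`, `‖Aᵢ‖ ≤ K Nᵢ`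
    have hAK₁ : ‖A₁ j‖ ≤ K * N₁ := by
      rw [hA₁, hN₁]; exact norm_integral_smul_curl_le hwj hK0 hKj h₁ h₁c
    have hAK₂ : ‖A₂ j‖ ≤ K * N₂ := by
      rw [hA₂, hN₂]; exact norm_integral_smul_curl_le hwj hK0 hKj h₂ h₂c
    have hme₁ : m₁ ≤ ‖e‖ * m₁ + d j * I₁ := by
      rw [hm₁, hI₁]; exact mass_le_of_refDirection hωc h₁.continuous h₁c h₁0 h₁s hmass
    have hme₂ : m₂ ≤ ‖e‖ * m₂ + d j * I₂ := by
      rw [hm₂, hI₂]; exact mass_le_of_refDirection hωc h₂.continuous h₂c h₂0 h₂s hmass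
    have hem : ∀ {A : (EuclideanSpace ℝ (Fin 3))} {m δ : ℝ}, 0 ≤ m → ‖A - m • e‖ ≤ δ → ‖e‖ * m ≤ ‖A‖ + δ := by
      intro A m δ hm hδ
      have h1 : ‖m • e‖ ≤ ‖A‖ + ‖A - m • e‖ := by
        calc ‖m • e‖ = ‖A - (A - m • e)‖ := by rw [sub_sub_cancel]
          _ ≤ ‖A‖ + ‖A - m • e‖ := norm_sub_le _ _
      rw [norm_smul, Real.norm_of_nonneg hm, mul_comm] at h1
      linarith
    have hem₁ := hem hm₁0 hD₁
    have hem₂ := hem hm₂0 hD₂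
    have hmb₁ : m₁ ≤ Mb₁ := by
      rw [hMb₁]
      linarith only [hme₁, hem₁, hAK₁, mul_le_mul_of_nonneg_right hsm.1 hm₁0,
        mul_le_mul_of_nonneg_right hsm.2 hI₁0, hI₁0, hm₁0]
    have hmb₂ : m₂ ≤ Mb₂ := by
      rw [hMb₂]
      linarith only [hme₂, hem₂, hAK₂, mul_le_mul_of_nonneg_right hsm.1 hm₂0,
        mul_le_mul_of_nonneg_right hsm.2 hI₂0, hI₂0, hm₂0]
    -- defects bounded by `(ε + d) Pᵢ`
    have hδ₁ : ε j * m₁ + 2 * d j * I₁ ≤ (ε j + d j) * P₁ := by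
      rw [hP₁]
      linarith only [mul_le_mul_of_nonneg_left hmb₁ (hε0 j), mul_nonneg (hd0 j) hMb₁0,
        mul_nonneg (hε0 j) hI₁0]
    have hδ₂ : ε j * m₂ + 2 * d j * I₂ ≤ (ε j + d j) * P₂ := by
      rw [hP₂]
      linarith only [mul_le_mul_of_nonneg_left hmb₂ (hε0 j), mul_nonneg (hd0 j) hMb₂0,
        mul_nonneg (hε0 j) hI₂0]
    have key := inner_ge_of_near_parallel he1 hAm₁ hAm₂ (hD₁.trans hδ₁) (hD₂.trans hδ₂)
    -- the error term is at most `C₀ (ε + d)`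
    have h0 : 0 ≤ ε j + d j := add_nonneg (hε0 j) (hd0 j)
    have hsum : ε j + d j ≤ 1 := by linarith only [hsm.1, hsm.2]
    have herr : m₁ * ((ε j + d j) * P₂) + m₂ * ((ε j + d j) * P₁) +
        (ε j + d j) * P₁ * ((ε j + d j) * P₂) ≤ C₀ * (ε j + d j) := by
      rw [hC₀]
      have t1 : m₁ * ((ε j + d j) * P₂) ≤ Mb₁ * ((ε j + d j) * P₂) :=
        mul_le_mul_of_nonneg_right hmb₁ (mul_nonneg h0 hP₂0)
      have t2 : m₂ * ((ε j + d j) * P₁) ≤ Mb₂ * ((ε j + d j) * P₁) :=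
        mul_le_mul_of_nonneg_right hmb₂ (mul_nonneg h0 hP₁0)
      have hsq : (ε j + d j) * (ε j + d j) ≤ ε j + d j := by nlinarith only [h0, hsum]
      have t3 : (ε j + d j) * (ε j + d j) * (P₁ * P₂) ≤ (ε j + d j) * (P₁ * P₂) :=
        mul_le_mul_of_nonneg_right hsq (mul_nonneg hP₁0 hP₂0)
      linarith only [t1, t2, t3]
    linarith only [key, herr]
  -- ### the limit
  have hA₁lim : Tendsto A₁ atTop (𝓝 (∫ y, ψ₁ y • curl V y)) := by
    have h := tendsto_integral_smul_curl_of_tendsto hw hV hK hconv h₁ h₁c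
    exact h.congr fun j => (hA₁ j).symm
  have hA₂lim : Tendsto A₂ atTop (𝓝 (∫ y, ψ₂ y • curl V y)) := by
    have h := tendsto_integral_smul_curl_of_tendsto hw hV hK hconv h₂ h₂c
    exact h.congr fun j => (hA₂ j).symm
  have hεd : Tendsto (fun j => 2 * C₀ * (ε j + d j)) atTop (𝓝 0) := by
    simpa using (hε.add hd).const_mul (2 * C₀)
  have hL : Tendsto (fun j => ‖A₁ j‖ * ‖A₂ j‖ - 2 * C₀ * (ε j + d j)) atTop
      (𝓝 (‖∫ y, ψ₁ y • curl V y‖ * ‖∫ y, ψ₂ y • curl V y‖ - 0)) :=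
    (hA₁lim.norm.mul hA₂lim.norm).sub hεd
  rw [sub_zero] at hL
  exact le_of_tendsto_of_tendsto hL (hA₁lim.inner hA₂lim) hpre

/-- **WEAK LIMITS OF ASYMPTOTICALLY ALIGNED VORTICITIES ARE UNIDIRECTIONAL.** Let `w_j → V`
pointwise, with `w_j ∈ C¹` and `‖w_j‖ ≤ K` eventually and `V ∈ C¹`, and suppose that on every ball
`B(0, R)` the vorticity directions `ξ_j = curl w_j/|curl w_j|` at pairs of points where
`|curl w_j| > d_j` differ by at most `ε_j`, with `ε_j → 0`, `d_j → 0`. Then the vorticity of the limit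
is UNIDIRECTIONAL: `curl V = |curl V| ζ₀` for one vector `ζ₀` (the near-parallelism of the weighted
vorticity vectors passes to the weak limit, localises at pairs of points through normalised bump
weights, and equality in Cauchy–Schwarz gives the common direction). No convergence of derivatives
is assumed. [folklore] -/
theorem exists_unidirectional_curl_of_tendsto_of_aligned (hw : ∀ᶠ j in atTop, ContDiff ℝ 1 (w j))
    (hV : ContDiff ℝ 1 V) (hK0 : 0 ≤ K) (hK : ∀ᶠ j in atTop, ∀ y, ‖w j y‖ ≤ K)
    (hconv : ∀ y, Tendsto (fun j => w j y) atTop (𝓝 (V y)))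
    (halign : ∀ R : ℝ, ∃ ε d : ℕ → ℝ, Tendsto ε atTop (𝓝 0) ∧ Tendsto d atTop (𝓝 0) ∧
      (∀ j, 0 ≤ ε j) ∧ (∀ j, 0 ≤ d j) ∧
      ∀ᶠ j in atTop, ∀ y ∈ ball (0 : (EuclideanSpace ℝ (Fin 3))) R, ∀ y' ∈ ball (0 : (EuclideanSpace ℝ (Fin 3))) R,
        d j < ‖curl (w j) y‖ → d j < ‖curl (w j) y'‖ →
          ‖vorticityDirection (curl (w j)) y - vorticityDirection (curl (w j)) y'‖ ≤ ε j) :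
    ∃ ζ₀ : (EuclideanSpace ℝ (Fin 3)), ∀ y, curl V y = ‖curl V y‖ • ζ₀ := by
  set Ω : (EuclideanSpace ℝ (Fin 3)) → (EuclideanSpace ℝ (Fin 3)) := curl V with hΩ
  have hΩc : Continuous Ω := continuous_curl hV
  refine exists_eq_norm_smul_of_forall_inner_eq fun y₁ y₂ => le_antisymm (real_inner_le_norm _ _) ?_
  -- `‖Ω y₁‖ ‖Ω y₂‖ ≤ ⟪Ω y₁, Ω y₂⟫`, by approximation with normalised bumps
  by_cases hz₁ : Ω y₁ = 0
  · rw [hz₁, norm_zero, zero_mul, inner_zero_left]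
  by_cases hz₂ : Ω y₂ = 0
  · rw [hz₂, norm_zero, mul_zero, inner_zero_right]
  have hn₁ : 0 < ‖Ω y₁‖ := norm_pos_iff.2 hz₁
  have hn₂ : 0 < ‖Ω y₂‖ := norm_pos_iff.2 hz₂
  refine le_of_forall_pos_lt_add fun κ' hκ' => ?_
  -- the tolerance
  set κ : ℝ := min (min (‖Ω y₁‖) (‖Ω y₂‖)) (κ' / (2 * ‖Ω y₁‖ + 2 * ‖Ω y₂‖ + 2)) with hκ
  have hκ0 : 0 < κ := by positivity
  have hκ₁ : κ ≤ ‖Ω y₁‖ := (min_le_left _ _).trans (min_le_left _ _)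
  have hκ₂ : κ ≤ ‖Ω y₂‖ := (min_le_left _ _).trans (min_le_right _ _)
  have hκ' : κ * (2 * ‖Ω y₁‖ + 2 * ‖Ω y₂‖ + 2) ≤ κ' := by
    have h := min_le_right (min (‖Ω y₁‖) (‖Ω y₂‖)) (κ' / (2 * ‖Ω y₁‖ + 2 * ‖Ω y₂‖ + 2))
    rw [← hκ] at h
    have hpos : 0 < 2 * ‖Ω y₁‖ + 2 * ‖Ω y₂‖ + 2 := by positivity
    calc κ * (2 * ‖Ω y₁‖ + 2 * ‖Ω y₂‖ + 2)
        ≤ κ' / (2 * ‖Ω y₁‖ + 2 * ‖Ω y₂‖ + 2) * (2 * ‖Ω y₁‖ + 2 * ‖Ω y₂‖ + 2) :=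
          mul_le_mul_of_nonneg_right h hpos.le
      _ = κ' := div_mul_cancel₀ _ hpos.ne'
  -- radii of continuity
  obtain ⟨r₁, hr₁, hr₁κ⟩ : ∃ r > 0, ∀ y, dist y y₁ < r → ‖Ω y - Ω y₁‖ ≤ κ := by
    obtain ⟨r, hr, h⟩ := Metric.continuousAt_iff.1 hΩc.continuousAt κ hκ0
    exact ⟨r, hr, fun y hy => by rw [← dist_eq_norm]; exact (h hy).le⟩
  obtain ⟨r₂, hr₂, hr₂κ⟩ : ∃ r > 0, ∀ y, dist y y₂ < r → ‖Ω y - Ω y₂‖ ≤ κ := by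
    obtain ⟨r, hr, h⟩ := Metric.continuousAt_iff.1 hΩc.continuousAt κ hκ0
    exact ⟨r, hr, fun y hy => by rw [← dist_eq_norm]; exact (h hy).le⟩
  -- normalised bumps
  let b₁ : ContDiffBump y₁ := ⟨r₁ / 4, r₁ / 2, by positivity, by linarith⟩
  let b₂ : ContDiffBump y₂ := ⟨r₂ / 4, r₂ / 2, by positivity, by linarith⟩
  set ψ₁ : (EuclideanSpace ℝ (Fin 3)) → ℝ := b₁.normed volume with hψ₁
  set ψ₂ : (EuclideanSpace ℝ (Fin 3)) → ℝ := b₂.normed volume with hψ₂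
  have h₁ : ContDiff ℝ 1 ψ₁ := b₁.contDiff_normed
  have h₂ : ContDiff ℝ 1 ψ₂ := b₂.contDiff_normed
  have h₁c : HasCompactSupport ψ₁ := b₁.hasCompactSupport_normed
  have h₂c : HasCompactSupport ψ₂ := b₂.hasCompactSupport_normed
  have h₁0 : ∀ y, 0 ≤ ψ₁ y := fun y => b₁.nonneg_normed y
  have h₂0 : ∀ y, 0 ≤ ψ₂ y := fun y => b₂.nonneg_normed y
  have h₁int : ∫ y, ψ₁ y = 1 := b₁.integral_normed
  have h₂int : ∫ y, ψ₂ y = 1 := b₂.integral_normed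
  have h₁supp : support ψ₁ = ball y₁ (r₁ / 2) := b₁.support_normed_eq
  have h₂supp : support ψ₂ = ball y₂ (r₂ / 2) := b₂.support_normed_eq
  -- both supports lie in `B(0, R)`
  set R : ℝ := ‖y₁‖ + ‖y₂‖ + r₁ + r₂ + 1 with hR
  have hball : ∀ {c : (EuclideanSpace ℝ (Fin 3))} {ρ : ℝ}, ‖c‖ + ρ ≤ R → ball c ρ ⊆ ball (0 : (EuclideanSpace ℝ (Fin 3))) R := by
    intro c ρ h y hy
    rw [mem_ball, dist_zero_right]
    rw [mem_ball, dist_eq_norm] at hy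
    calc ‖y‖ = ‖(y - c) + c‖ := by rw [sub_add_cancel]
      _ ≤ ‖y - c‖ + ‖c‖ := norm_add_le _ _
      _ < ρ + ‖c‖ := by linarith
      _ ≤ R := by linarith
  have h₁s : support ψ₁ ⊆ ball (0 : (EuclideanSpace ℝ (Fin 3))) R := by
    rw [h₁supp]; exact hball (by rw [hR]; linarith [norm_nonneg y₂])
  have h₂s : support ψ₂ ⊆ ball (0 : (EuclideanSpace ℝ (Fin 3))) R := by
    rw [h₂supp]; exact hball (by rw [hR]; linarith [norm_nonneg y₁])
  -- the limit inequality for the bumps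
  obtain ⟨ε, d, hε, hd, hε0, hd0, halj⟩ := halign R
  have key := norm_mul_norm_le_inner_integral_smul_curl hw hV hK0 hK hconv hε hd hε0 hd0 halj
    h₁ h₁c h₁0 h₁s h₂ h₂c h₂0 h₂s
  -- the bump averages are within `κ` of the point values
  have happrox : ∀ {c : (EuclideanSpace ℝ (Fin 3))} {ψ : (EuclideanSpace ℝ (Fin 3)) → ℝ} {ρ : ℝ}, ContDiff ℝ 1 ψ → HasCompactSupport ψ →
      (∀ y, 0 ≤ ψ y) → ∫ y, ψ y = 1 → support ψ = ball c ρ →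
      (∀ y, dist y c < ρ → ‖Ω y - Ω c‖ ≤ κ) → ‖(∫ y, ψ y • Ω y) - Ω c‖ ≤ κ := by
    intro c ψ ρ hψ hψc hψ0 hψ1 hψs hκc
    have hic : Integrable (fun y => ψ y • Ω y) :=
      (hψ.continuous.smul hΩc).integrable_of_hasCompactSupport (hψc.smul_right (f' := Ω))
    have hiψ : Integrable ψ := hψ.continuous.integrable_of_hasCompactSupport hψc
    have e0 : ∫ y, ψ y • Ω c = Ω c := by rw [integral_smul_const, hψ1, one_smul]
    have e1 : (∫ y, ψ y • Ω y) - Ω c = ∫ y, ψ y • (Ω y - Ω c) := by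
      calc (∫ y, ψ y • Ω y) - Ω c = (∫ y, ψ y • Ω y) - ∫ y, ψ y • Ω c := by rw [e0]
        _ = ∫ y, (ψ y • Ω y - ψ y • Ω c) := (integral_sub hic (hiψ.smul_const _)).symm
        _ = ∫ y, ψ y • (Ω y - Ω c) :=
            integral_congr_ae (Eventually.of_forall fun y => by simp only [smul_sub])
    rw [e1]
    have hpt : ∀ y, ‖ψ y • (Ω y - Ω c)‖ ≤ κ * ψ y := by
      intro y
      by_cases hy : y ∈ support ψ
      · rw [hψs, mem_ball] at hy
        rw [norm_smul, Real.norm_of_nonneg (hψ0 y), mul_comm]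
        exact mul_le_mul_of_nonneg_right (hκc y hy) (hψ0 y)
      · rw [notMem_support] at hy
        simp [hy]
    calc ‖∫ y, ψ y • (Ω y - Ω c)‖ ≤ ∫ y, ‖ψ y • (Ω y - Ω c)‖ := norm_integral_le_integral_norm _
      _ ≤ ∫ y, κ * ψ y := integral_mono_of_nonneg (Eventually.of_forall fun y => norm_nonneg _)
          (hiψ.const_mul κ) (Eventually.of_forall hpt)
      _ = κ := by rw [integral_const_mul, hψ1, mul_one]
  have ha₁ := happrox h₁ h₁c h₁0 h₁int h₁supp (fun y hy => hr₁κ y (by linarith [hy]))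
  have ha₂ := happrox h₂ h₂c h₂0 h₂int h₂supp (fun y hy => hr₂κ y (by linarith [hy]))
  set a₁ : (EuclideanSpace ℝ (Fin 3)) := ∫ y, ψ₁ y • Ω y with ha₁def
  set a₂ : (EuclideanSpace ℝ (Fin 3)) := ∫ y, ψ₂ y • Ω y with ha₂def
  clear_value a₁ a₂
  -- elementary inner-product algebra
  have hin : ⟪a₁, a₂⟫ ≤ ⟪Ω y₁, Ω y₂⟫ + κ * (‖Ω y₂‖ + κ) + ‖Ω y₁‖ * κ := by
    have e1 : ⟪a₁, a₂⟫ - ⟪Ω y₁, Ω y₂⟫ = ⟪a₁ - Ω y₁, a₂⟫ + ⟪Ω y₁, a₂ - Ω y₂⟫ := by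
      rw [inner_sub_left, inner_sub_right]; ring
    have e2 : ‖a₂‖ ≤ ‖Ω y₂‖ + κ := by
      calc ‖a₂‖ = ‖(a₂ - Ω y₂) + Ω y₂‖ := by rw [sub_add_cancel]
        _ ≤ ‖a₂ - Ω y₂‖ + ‖Ω y₂‖ := norm_add_le _ _
        _ ≤ ‖Ω y₂‖ + κ := by linarith
    have e3 : ⟪a₁ - Ω y₁, a₂⟫ ≤ κ * (‖Ω y₂‖ + κ) :=
      (real_inner_le_norm _ _).trans (mul_le_mul ha₁ e2 (norm_nonneg _) hκ0.le)
    have e4 : ⟪Ω y₁, a₂ - Ω y₂⟫ ≤ ‖Ω y₁‖ * κ :=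
      (real_inner_le_norm _ _).trans (mul_le_mul_of_nonneg_left ha₂ (norm_nonneg _))
    linarith
  have hno₁ : ‖Ω y₁‖ - κ ≤ ‖a₁‖ := by
    have : ‖Ω y₁‖ ≤ ‖a₁‖ + ‖a₁ - Ω y₁‖ := by
      calc ‖Ω y₁‖ = ‖a₁ - (a₁ - Ω y₁)‖ := by rw [sub_sub_cancel]
        _ ≤ ‖a₁‖ + ‖a₁ - Ω y₁‖ := norm_sub_le _ _
    linarith
  have hno₂ : ‖Ω y₂‖ - κ ≤ ‖a₂‖ := by
    have : ‖Ω y₂‖ ≤ ‖a₂‖ + ‖a₂ - Ω y₂‖ := by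
      calc ‖Ω y₂‖ = ‖a₂ - (a₂ - Ω y₂)‖ := by rw [sub_sub_cancel]
        _ ≤ ‖a₂‖ + ‖a₂ - Ω y₂‖ := norm_sub_le _ _
    linarith
  have hprod : (‖Ω y₁‖ - κ) * (‖Ω y₂‖ - κ) ≤ ‖a₁‖ * ‖a₂‖ :=
    mul_le_mul hno₁ hno₂ (by linarith) (norm_nonneg _)
  nlinarith [key, hn₁, hn₂, hκ0]

end Limit

end Summit.NavierStokesRegularity.FluidComputer

end
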